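import Mathlib

/-!
# C-025 at q = 3: the line-profile constraints of the tail count (★★) for a linear space (night-3 g2)

N3-TAIL-LOSSY.md §6 (ii): in a simple plane (a linear space: every two distinct points lie on exactly one line) with a longest line `ℓ₁` of
`k` points, every other line meets `ℓ₁` in at most one point — so it has at most `min(k, g − k + 1)` points — and the pair sets of the other
lines off `ℓ₁` are pairwise disjoint, so `Σ_{ℓ ≠ ℓ₁} C(|ℓ| − 1, 2) ≤ C(g − k, 2)`.  These are the two hypotheses of `Profile` / `profile_le_A`
(RLSStarStarArith, RLSTailProfile); this file proves them for any finite linear space.  No `decide`.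
-/

namespace PercRepro.NightThree.LinSp

open Finset

variable {α : Type*} [DecidableEq α]

/-- A finite linear space on the point set `pts`: lines are subsets of `pts` with at least two points, and any two distinct points lie
on exactly one line. -/
structure LinearSpace (pts : Finset α) where
  lines : Finset (Finset α)
  sub : ∀ ℓ ∈ lines, ℓ ⊆ pts
  two_le : ∀ ℓ ∈ lines, 2 ≤ ℓ.card
  exists_line : ∀ a ∈ pts, ∀ b ∈ pts, a ≠ b → ∃ ℓ ∈ lines, a ∈ ℓ ∧ b ∈ ℓ
  unique_line : ∀ ℓ ∈ lines, ∀ ℓ' ∈ lines, ∀ a b, a ∈ ℓ → b ∈ ℓ → a ∈ ℓ' → b ∈ ℓ' → a ≠ b → ℓ = ℓ'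

variable {pts : Finset α} (L : LinearSpace pts)

/-- Two distinct lines share at most one point. -/
theorem card_inter_le_one {ℓ ℓ' : Finset α} (hℓ : ℓ ∈ L.lines) (hℓ' : ℓ' ∈ L.lines) (hne : ℓ ≠ ℓ') :
    (ℓ ∩ ℓ').card ≤ 1 := by
  by_contra h
  have h' : 1 < (ℓ ∩ ℓ').card := by omega
  obtain ⟨a, ha, b, hb, hab⟩ := Finset.one_lt_card.mp h'
  simp only [mem_inter] at ha hb
  exact hne (L.unique_line ℓ hℓ ℓ' hℓ' a b ha.1 hb.1 ha.2 hb.2 hab)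

/-- A line other than `ℓ₁` has at least `|ℓ| − 1` points off `ℓ₁`. -/
theorem card_sdiff_ge {ℓ ℓ₁ : Finset α} (hℓ : ℓ ∈ L.lines) (hℓ₁ : ℓ₁ ∈ L.lines) (hne : ℓ ≠ ℓ₁) :
    ℓ.card - 1 ≤ (ℓ \ ℓ₁).card := by
  have h1 := card_inter_le_one L hℓ hℓ₁ hne
  have h2 : (ℓ \ ℓ₁).card + (ℓ ∩ ℓ₁).card = ℓ.card := Finset.card_sdiff_add_card_inter ℓ ℓ₁
  omega

/-- The pair sets off `ℓ₁` of two distinct other lines are disjoint. -/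
theorem pairs_disjoint {ℓ ℓ' ℓ₁ : Finset α} (hℓ : ℓ ∈ L.lines) (hℓ' : ℓ' ∈ L.lines) (hne : ℓ ≠ ℓ') :
    Disjoint ((ℓ \ ℓ₁).powersetCard 2) ((ℓ' \ ℓ₁).powersetCard 2) := by
  rw [Finset.disjoint_left]
  intro s hs hs'
  rw [Finset.mem_powersetCard] at hs hs'
  obtain ⟨a, b, hab, rfl⟩ := Finset.card_eq_two.mp hs.2
  have ha : a ∈ ℓ \ ℓ₁ := hs.1 (by simp)
  have hb : b ∈ ℓ \ ℓ₁ := hs.1 (by simp)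
  have ha' : a ∈ ℓ' \ ℓ₁ := hs'.1 (by simp)
  have hb' : b ∈ ℓ' \ ℓ₁ := hs'.1 (by simp)
  simp only [mem_sdiff] at ha hb ha' hb'
  exact hne (L.unique_line ℓ hℓ ℓ' hℓ' a b ha.1 hb.1 ha'.1 hb'.1 hab)

/-- `Σ_{ℓ ≠ ℓ₁} C(|ℓ| − 1, 2) ≤ C(g − k, 2)` where `k = |ℓ₁|`, `g = |pts|`. -/
theorem sum_pairs_le {ℓ₁ : Finset α} (hℓ₁ : ℓ₁ ∈ L.lines) :
    ∑ ℓ ∈ L.lines.erase ℓ₁, (ℓ.card - 1).choose 2 ≤ (pts.card - ℓ₁.card).choose 2 := by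
  have hsub : ∀ ℓ ∈ L.lines.erase ℓ₁, (ℓ \ ℓ₁).powersetCard 2 ⊆ (pts \ ℓ₁).powersetCard 2 := by
    intro ℓ hℓ
    apply Finset.powersetCard_mono
    exact Finset.sdiff_subset_sdiff (L.sub ℓ (Finset.mem_of_mem_erase hℓ)) (le_refl _)
  calc ∑ ℓ ∈ L.lines.erase ℓ₁, (ℓ.card - 1).choose 2
      ≤ ∑ ℓ ∈ L.lines.erase ℓ₁, ((ℓ \ ℓ₁).powersetCard 2).card := by
        apply Finset.sum_le_sum
        intro ℓ hℓ
        rw [Finset.card_powersetCard]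
        exact Nat.choose_le_choose 2 (card_sdiff_ge L (Finset.mem_of_mem_erase hℓ) hℓ₁ (Finset.ne_of_mem_erase hℓ))
    _ = ((L.lines.erase ℓ₁).biUnion (fun ℓ => (ℓ \ ℓ₁).powersetCard 2)).card := by
        rw [Finset.card_biUnion]
        intro ℓ hℓ ℓ' hℓ' hne
        exact pairs_disjoint L (Finset.mem_of_mem_erase hℓ) (Finset.mem_of_mem_erase hℓ') hne
    _ ≤ ((pts \ ℓ₁).powersetCard 2).card := by
        apply Finset.card_le_card
        intro s hs
        rw [Finset.mem_biUnion] at hs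
        obtain ⟨ℓ, hℓ, hs⟩ := hs
        exact hsub ℓ hℓ hs
    _ = (pts.card - ℓ₁.card).choose 2 := by
        rw [Finset.card_powersetCard, Finset.card_sdiff_of_subset (L.sub ℓ₁ hℓ₁)]

/-- Every other line has at most `g − k + 1` points. -/
theorem card_le_of_ne {ℓ ℓ₁ : Finset α} (hℓ : ℓ ∈ L.lines) (hℓ₁ : ℓ₁ ∈ L.lines) (hne : ℓ ≠ ℓ₁) :
    ℓ.card ≤ pts.card - ℓ₁.card + 1 := by
  have h1 := card_sdiff_ge L hℓ hℓ₁ hne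
  have h2 : (ℓ \ ℓ₁).card ≤ (pts \ ℓ₁).card :=
    Finset.card_le_card (Finset.sdiff_subset_sdiff (L.sub ℓ hℓ) (le_refl _))
  rw [Finset.card_sdiff_of_subset (L.sub ℓ₁ hℓ₁)] at h2
  omega

/-- The two profile constraints of `Profile` for a longest line `ℓ₁`: as a list of the other lines' point counts. -/
theorem profile_constraints {ℓ₁ : Finset α} (hℓ₁ : ℓ₁ ∈ L.lines) (hmax : ∀ ℓ ∈ L.lines, ℓ.card ≤ ℓ₁.card) :
    (∀ k' ∈ (L.lines.erase ℓ₁).toList.map Finset.card, k' ≤ min ℓ₁.card (pts.card - ℓ₁.card + 1)) ∧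
    (((L.lines.erase ℓ₁).toList.map Finset.card).map (fun k' => (k' - 1).choose 2)).sum ≤ (pts.card - ℓ₁.card).choose 2 := by
  constructor
  · intro k' hk'
    rw [List.mem_map] at hk'
    obtain ⟨ℓ, hℓ, rfl⟩ := hk'
    rw [Finset.mem_toList] at hℓ
    exact le_min (hmax ℓ (Finset.mem_of_mem_erase hℓ)) (card_le_of_ne L (Finset.mem_of_mem_erase hℓ) hℓ₁ (Finset.ne_of_mem_erase hℓ))
  · rw [List.map_map, Finset.sum_map_toList]
    exact sum_pairs_le L hℓ₁

end PercRepro.NightThree.LinSp
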